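import Literature.Analysis.FluidPDE.SelfSimilar
import Literature.Analysis.FluidPDE.SpaceTimeRescaling
import Literature.Analysis.FluidPDE.ForwardDSSExtension
import Literature.Dynamics.TopologicalDynamics.UniformRecurrence
import HarnessLib

/-!
# Uniform recurrence of a space–time field under the Navier–Stokes scaling flow

Topic `Literature/Analysis/FluidPDE` (definition request `defn-IsScalingUniformlyRecurrent`, route
NavierStokesRegularity/RecurrentProfiles, items `RecurrentLiouville`, `RecurrentReduction`,
`RecurrentRegularIsTrivial`, which inline the predicate verbatim).

The Navier–Stokes scaling `u ↦ u_λ`, `u_λ(t, x) = λ u(λ² t, λ x)` (`Literature.Analysis.FluidPDE.nsRescale`,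
Leray 1934, §20) becomes, in logarithmic scale `σ = log λ`, an ACTION OF `(ℝ, +)` on space–time
fields: `nsScalingFlow σ u = nsRescale (exp σ) u`, `nsScalingFlow (σ + τ) = nsScalingFlow σ ∘ nsScalingFlow τ`
(`nsScalingFlow_add`). Its fixed points are the (backward/forward) self-similar fields
(`IsSelfSimilar`), its periodic orbits the discretely self-similar ones (`IsDiscretelySelfSimilar`,
period `log λ`). Following Birkhoff and Furstenberg (`Literature.Dynamics.TopologicalDynamics.IsUniformlyRecurrentPt`),
a field `u : ℝ → E → F` is **uniformly recurrent under scaling in `L³_loc` of the closed lower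
half-space** `{t ≤ 0} × E` if for every `ε > 0` and every compact `K ⊆ {t ≤ 0} × E` the set of
`ε`-return log-scales `{σ | ‖u_{e^σ} − u‖_{L³(K)} ≤ ε}` is syndetic (relatively dense) in `ℝ`:
some `L > 0` such that every window `[a, a + L]` contains one (`IsScalingUniformlyRecurrent`,
stated LETTER FOR LETTER as inlined in the route, so that the route items restate by `Iff.rfl`;
`isScalingUniformlyRecurrent_iff_isSyndetic` is the bridge to the general vocabulary).

## Contents

* `nsScalingFlow` and its action laws; `IsDiscretelySelfSimilar.zpow` (a `λ`-DSS field is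
  `λⁿ`-DSS for all `n ∈ ℤ`; the `ℕ`-power / inverse steps are REUSED from the tree,
  `BradshawTsai2019.isDiscretelySelfSimilar_pow` / `_inv` in `ForwardDSSExtension.lean`, hence that
  import) and `IsDiscretelySelfSimilar.nsScalingFlow_int_mul_log`.
* `IsScalingUniformlyRecurrent` (the definition) and `isScalingUniformlyRecurrent_iff_isSyndetic`.
* (i) fixed points and periodic orbits are uniformly recurrent:
  `IsSelfSimilar.isScalingUniformlyRecurrent`, `IsDiscretelySelfSimilar.isScalingUniformlyRecurrent`
  (`1 < λ`; for `0 < λ < 1` pass to `λ⁻¹`, `BradshawTsai2019.isDiscretelySelfSimilar_inv`),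
  `isScalingUniformlyRecurrent_zero`,
  and Leray's self-similar fields `isScalingUniformlyRecurrent_lerayBackward_zero` /
  `isScalingUniformlyRecurrent_lerayForward` (non-vacuity beyond `u = 0`).
* (ii) invariance along the orbit: `IsScalingUniformlyRecurrent.nsRescale` (`0 < c`), from the exact
  scaling law `eLpNorm_nsRescale_restrict_preimage` of `L^p` norms on parabolically dilated sets.
* (iii) invariance under modification on a null set of the OPEN half-space `{t < 0} × E` (where
  ancient solutions live; `{t = 0} × E` is null): `IsScalingUniformlyRecurrent.congr_ae`.
* (iv) the dictionary with topological dynamics, for any topological model `X` of a space of fields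
  (a map `ι : X → (ℝ → E → F)` and a flow `ϕ` on `X` covering the scaling flow along the orbit of
  `p`): if the `L³(K)`-balls about `p` are neighbourhoods then a uniformly recurrent point `p` of
  `ϕ` has a uniformly recurrent field `ι p` (`IsUniformlyRecurrentPt.isScalingUniformlyRecurrent`),
  and conversely when these balls form a neighbourhood base
  (`IsScalingUniformlyRecurrent.isUniformlyRecurrentPt`). Combined with Birkhoff's theorem
  `Literature.Dynamics.TopologicalDynamics.exists_isUniformlyRecurrentPt` (every nonempty compact
  invariant set of a flow by continuous maps carries a uniformly recurrent point) this is the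
  "minimal sets consist of uniformly recurrent points" step of the route's reduction.
* one-sided consequences `IsScalingUniformlyRecurrent.exists_le` / `.exists_ge` (return scales
  `σ → ∓∞`).

## Design notes

* `E` is a finite-dimensional real inner product space with its Borel σ-algebra, so that `volume`
  on `ℝ × E` is Lebesgue measure (`measureSpaceOfInnerProductSpace`, as for `EuclideanSpace ℝ (Fin 3)`
  in the route); `F` is any real normed space. The exponent `3` and the half-space `{t ≤ 0}` are
  those of the request (the `L³_loc` topology of the local-energy class of ancient solutions,
  Albritton–Barker 2019, Lemma 2.2); nothing here uses that `u` solves any equation.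
* Mathlib/tree search: no `syndetic`/`uniformlyRecurrent`/`almostPeriodic` notion for flows in
  Mathlib; the tree's `IsAlmostPeriodicModSymm` (Kenig–Merle critical elements,
  `CriticalElement.lean`) is compactness modulo symmetries of a trajectory in `Ḣ^{1/2}`, a different
  notion. The change of variables is the tree's `stAffine`/`map_stAffine_volume_restrict_preimage`
  (`SpaceTimeRescaling.lean`): `nsRescale c w (s, y) = c • w (stAffine (c²) c 0 0 (s, y))`.

## References

* G. D. Birkhoff, *Dynamical Systems* (1927), Ch. VII (recurrent motions, minimal sets).
* H. Furstenberg, *Recurrence in Ergodic Theory and Combinatorial Number Theory* (1981), Ch. 1 §4.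
* J. Leray, *Sur le mouvement d'un liquide visqueux emplissant l'espace*, Acta Math. 63 (1934), §20.
* D. Albritton, T. Barker, *Global weak Besov solutions of the Navier–Stokes equations and
  applications*, ARMA 232 (2019), Lemma 2.2 (compactness of the local-energy class in `L³_loc`).
* D. Chae, J. Wolf, *Existence of discretely self-similar solutions to the Navier–Stokes equations
  for initial value in `L²_loc(ℝ³)`*, AIHP C 35 (2018), Def. 1.1 (`λ`-DSS).
-/

noncomputable section

open MeasureTheory Set Function Filter Module
open scoped Topology ENNReal
open Literature.Dynamics.TopologicalDynamics

namespace Literature.Analysis.FluidPDE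

/-! ### The scaling flow in logarithmic time -/

section Flow

variable {E : Type*} [NormedAddCommGroup E] [NormedSpace ℝ E]
variable {F : Type*} [NormedAddCommGroup F] [NormedSpace ℝ F]

/-- The **Navier–Stokes scaling flow in logarithmic time**: `nsScalingFlow σ u = u_{e^σ}`,
`(nsScalingFlow σ u) t x = e^σ • u (e^{2σ} t) (e^σ x)`; an action of `(ℝ, +)` on space–time fields
(`nsScalingFlow_zero`, `nsScalingFlow_add`) whose time-`σ` map is `nsRescale (Real.exp σ)`
(Leray 1934, §20, in the logarithmic time of the similarity variables). [cite: Leray1934, §20] -/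
def nsScalingFlow (σ : ℝ) (u : ℝ → E → F) : ℝ → E → F :=
  nsRescale (Real.exp σ) u

/-- Unfolding `nsScalingFlow`. [folklore] -/
@[simp]
theorem nsScalingFlow_apply (σ : ℝ) (u : ℝ → E → F) :
    nsScalingFlow σ u = nsRescale (Real.exp σ) u :=
  rfl

/-- Time `0` of the scaling flow is the identity. [folklore] -/
theorem nsScalingFlow_zero (u : ℝ → E → F) : nsScalingFlow 0 u = u := by
  simp

/-- **Action law** of the scaling flow: `u_{e^{σ+τ}} = (u_{e^τ})_{e^σ}` (from the group law
`nsRescale_mul`). [folklore] -/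
theorem nsScalingFlow_add (σ τ : ℝ) (u : ℝ → E → F) :
    nsScalingFlow (σ + τ) u = nsScalingFlow σ (nsScalingFlow τ u) := by
  simp only [nsScalingFlow_apply, Real.exp_add]
  rw [mul_comm, nsRescale_mul]

/-- The time-`σ` maps of the scaling flow commute. [folklore] -/
theorem nsScalingFlow_comm (σ τ : ℝ) (u : ℝ → E → F) :
    nsScalingFlow σ (nsScalingFlow τ u) = nsScalingFlow τ (nsScalingFlow σ u) := by
  rw [← nsScalingFlow_add, add_comm, nsScalingFlow_add]

/-- Rescalings by two factors commute. [folklore] -/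
theorem nsRescale_comm (c d : ℝ) (u : ℝ → E → F) :
    nsRescale c (nsRescale d u) = nsRescale d (nsRescale c u) := by
  rw [← nsRescale_mul, mul_comm, nsRescale_mul]

/-- The rescaling is linear in the field: it commutes with subtraction. [folklore] -/
theorem nsRescale_sub (c : ℝ) (u v : ℝ → E → F) :
    nsRescale c (u - v) = nsRescale c u - nsRescale c v := by
  funext t x
  simp [smul_sub]

/-- The rescaling of the zero field is zero. [folklore] -/
@[simp]
theorem nsRescale_zero_field (c : ℝ) : nsRescale c (0 : ℝ → E → F) = 0 := by
  funext t x
  simp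

/-- A self-similar field is a FIXED POINT of the scaling flow. [folklore] -/
theorem IsSelfSimilar.nsScalingFlow_eq {u : ℝ → E → F} (h : IsSelfSimilar u) (σ : ℝ) :
    nsScalingFlow σ u = u :=
  h _ (Real.exp_pos σ)

/-- A `λ`-DSS field (`λ ≠ 0`) is `λⁿ`-DSS for every `n : ℤ`: the periodic orbit of the scaling
flow closes up after every integer number of periods `n log λ` (the `ℕ`-power and inverse steps are
the tree's `BradshawTsai2019.isDiscretelySelfSimilar_pow` / `_inv`, `ForwardDSSExtension.lean`). [folklore] -/
theorem IsDiscretelySelfSimilar.zpow {c : ℝ} (hc : c ≠ 0) {u : ℝ → E → F}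
    (h : IsDiscretelySelfSimilar c u) (n : ℤ) : IsDiscretelySelfSimilar (c ^ n) u := by
  obtain ⟨k, rfl | rfl⟩ := Int.eq_nat_or_neg n
  · rw [zpow_natCast]
    exact BradshawTsai2019.isDiscretelySelfSimilar_pow h k
  · rw [zpow_neg, zpow_natCast, ← inv_pow]
    exact BradshawTsai2019.isDiscretelySelfSimilar_pow
      (BradshawTsai2019.isDiscretelySelfSimilar_inv hc h) k

/-- For a `λ`-DSS field with `0 < λ`, the log-scales `n log λ`, `n ∈ ℤ`, are exact return times of
the scaling flow. [folklore] -/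
theorem IsDiscretelySelfSimilar.nsScalingFlow_int_mul_log {c : ℝ} (hc : 0 < c) {u : ℝ → E → F}
    (h : IsDiscretelySelfSimilar c u) (n : ℤ) : nsScalingFlow (n * Real.log c) u = u := by
  have h1 : Real.exp (n * Real.log c) = c ^ n := by
    rw [mul_comm, ← Real.rpow_def_of_pos hc, Real.rpow_intCast]
  rw [nsScalingFlow_apply, h1]
  exact h.zpow hc.ne' n

end Flow

/-! ### The parabolic dilation of space–time -/

section Dilation

variable {E : Type*} [NormedAddCommGroup E] [InnerProductSpace ℝ E]
variable {F : Type*} [NormedAddCommGroup F] [NormedSpace ℝ F]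

/-- The rescaled field as a pull-back along the parabolic dilation
`Φ_c = stAffine (c²) c 0 0 : (s, y) ↦ (c² s, c y)`: `u_c (s, y) = c • u (Φ_c (s, y))`. [folklore] -/
theorem nsRescale_eq_smul_comp_stAffine (c : ℝ) (w : ℝ → E → F) :
    (fun z : ℝ × E => nsRescale c w z.1 z.2) =
      c • ((fun z : ℝ × E => w z.1 z.2) ∘ stAffine (c ^ 2) c 0 (0 : E)) := by
  funext z
  simp [nsRescale_apply, stAffine]

/-- The parabolic dilation `Φ_c` (`c ≠ 0`) preserves the closed lower half-space `{t ≤ 0} × E`. [folklore] -/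
theorem stAffine_sq_preimage_Iic_prod_univ {c : ℝ} (hc : c ≠ 0) :
    stAffine (c ^ 2) c 0 (0 : E) ⁻¹' (Set.Iic (0 : ℝ) ×ˢ (Set.univ : Set E)) = Set.Iic 0 ×ˢ Set.univ := by
  have hc2 : 0 < c ^ 2 := by positivity
  ext ⟨s, y⟩
  simp only [mem_preimage, stAffine_apply, zero_add, mem_prod, mem_Iic, mem_univ, and_true]
  constructor
  · intro h; nlinarith
  · intro h; nlinarith

/-- The parabolic dilation `Φ_c` (`c ≠ 0`) preserves the open lower half-space `{t < 0} × E`. [folklore] -/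
theorem stAffine_sq_preimage_Iio_prod_univ {c : ℝ} (hc : c ≠ 0) :
    stAffine (c ^ 2) c 0 (0 : E) ⁻¹' (Set.Iio (0 : ℝ) ×ˢ (Set.univ : Set E)) = Set.Iio 0 ×ˢ Set.univ := by
  have hc2 : 0 < c ^ 2 := by positivity
  ext ⟨s, y⟩
  simp only [mem_preimage, stAffine_apply, zero_add, mem_prod, mem_Iio, mem_univ, and_true]
  constructor
  · intro h; nlinarith
  · intro h; nlinarith

/-- The image of a subset of the closed lower half-space under `Φ_c` stays in it. [folklore] -/
theorem image_stAffine_sq_subset_Iic_prod_univ (c : ℝ) {K : Set (ℝ × E)}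
    (hK : K ⊆ Set.Iic (0 : ℝ) ×ˢ Set.univ) :
    stAffine (c ^ 2) c 0 (0 : E) '' K ⊆ Set.Iic 0 ×ˢ Set.univ := by
  rintro _ ⟨⟨s, y⟩, hz, rfl⟩
  have hs : s ≤ 0 := (hK hz).1
  simp only [stAffine_apply, zero_add, mem_prod, mem_Iic, mem_univ, and_true]
  nlinarith [sq_nonneg c]

end Dilation

/-! ### Uniform recurrence under scaling -/

section Recurrence

variable {E : Type*} [NormedAddCommGroup E] [InnerProductSpace ℝ E] [FiniteDimensional ℝ E]
  [MeasurableSpace E] [BorelSpace E]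
variable {F : Type*} [NormedAddCommGroup F] [NormedSpace ℝ F]

/-- A space–time field `u : ℝ → E → F` (time first) is **uniformly recurrent under the
Navier–Stokes scaling in `L³_loc` of the closed lower half-space** `{t ≤ 0} × E` (Birkhoff
recurrence / uniform recurrence in the sense of Furstenberg 1981, Ch. 1 §4, for the scaling flow
`σ ↦ u_{e^σ} = nsRescale (exp σ) u`): for every `ε > 0` and every compact `K ⊆ {t ≤ 0} × E` there
is `L > 0` such that every window `[a, a + L]` of log-scales contains some `σ` with
`‖u_{e^σ} − u‖_{L³(K)} ≤ ε` — the `ε`-return log-scales form a syndetic (relatively dense) subset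
of `ℝ` (`isScalingUniformlyRecurrent_iff_isSyndetic`). Self-similar fields (fixed points) and
`λ`-DSS fields (periodic orbits) are uniformly recurrent; so is every point of a minimal set of the
scaling flow in a compact family (Birkhoff). This is Furstenberg's Def. 1.8 for the system
(fields on `{t ≤ 0} × E` with the `L³_loc` topology, scaling flow); stated letter for letter as
inlined in route NavierStokesRegularity/RecurrentProfiles. [cite: Furstenberg1981, Ch. 1 §4, Def. 1.8] -/
def IsScalingUniformlyRecurrent (u : ℝ → E → F) : Prop :=
  ∀ ε : ℝ, 0 < ε → ∀ K : Set (ℝ × E), IsCompact K → K ⊆ Set.Iic (0 : ℝ) ×ˢ Set.univ →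
    ∃ L : ℝ, 0 < L ∧ ∀ a : ℝ, ∃ σ ∈ Set.Icc a (a + L),
      MeasureTheory.eLpNorm (fun z : ℝ × E => nsRescale (Real.exp σ) u z.1 z.2 - u z.1 z.2) 3
        (MeasureTheory.volume.restrict K) ≤ ENNReal.ofReal ε

/-- **Bridge to topological dynamics**: `u` is uniformly recurrent under scaling iff for every
`ε > 0` and every compact `K ⊆ {t ≤ 0} × E` the set of `ε`-return log-scales
`{σ | ‖u_{e^σ} − u‖_{L³(K)} ≤ ε}` is a syndetic subset of `ℝ`
(`Literature.Dynamics.TopologicalDynamics.IsSyndetic`, window form `isSyndetic_iff_exists_window`). [folklore] -/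
theorem isScalingUniformlyRecurrent_iff_isSyndetic {u : ℝ → E → F} :
    IsScalingUniformlyRecurrent u ↔
      ∀ ε : ℝ, 0 < ε → ∀ K : Set (ℝ × E), IsCompact K → K ⊆ Set.Iic (0 : ℝ) ×ˢ Set.univ →
        IsSyndetic {σ : ℝ | eLpNorm (fun z : ℝ × E => nsRescale (Real.exp σ) u z.1 z.2 - u z.1 z.2) 3
          (volume.restrict K) ≤ ENNReal.ofReal ε} := by
  simp only [IsScalingUniformlyRecurrent, isSyndetic_iff_exists_window, mem_setOf_eq]

/-- **Fixed points are uniformly recurrent**: a self-similar field (`u_λ = u` for all `λ > 0`: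
Leray's backward/forward self-similar solutions) is uniformly recurrent under scaling — every
log-scale is an exact return time. [folklore] -/
theorem IsSelfSimilar.isScalingUniformlyRecurrent {u : ℝ → E → F} (h : IsSelfSimilar u) :
    IsScalingUniformlyRecurrent u := by
  intro ε hε K _ _
  refine ⟨1, one_pos, fun a => ⟨a, ⟨le_rfl, by linarith⟩, ?_⟩⟩
  have h1 : (fun z : ℝ × E => nsRescale (Real.exp a) u z.1 z.2 - u z.1 z.2) = 0 := by
    funext z
    rw [h _ (Real.exp_pos a)]
    simp
  rw [h1, eLpNorm_zero]
  exact bot_le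

/-- The zero field is uniformly recurrent under scaling. [folklore] -/
theorem isScalingUniformlyRecurrent_zero : IsScalingUniformlyRecurrent (0 : ℝ → E → F) :=
  IsSelfSimilar.isScalingUniformlyRecurrent fun c _ => nsRescale_zero_field c

/-- Leray's backward self-similar fields `lerayBackward a 0 U` (blow-up time `T = 0`, ANY profile
`U`) are uniformly recurrent under scaling: they are fixed points of the scaling flow
(`isSelfSimilar_lerayBackward_zero`). Non-vacuity of the notion beyond `u = 0`. [folklore] -/
theorem isScalingUniformlyRecurrent_lerayBackward_zero (a : ℝ) (U : E → E) :
    IsScalingUniformlyRecurrent (lerayBackward a 0 U) :=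
  (isSelfSimilar_lerayBackward_zero a U).isScalingUniformlyRecurrent

/-- Leray's forward (expanding) self-similar fields `lerayForward a U` are uniformly recurrent under
scaling (`isSelfSimilar_lerayForward`). [folklore] -/
theorem isScalingUniformlyRecurrent_lerayForward (a : ℝ) (U : E → E) :
    IsScalingUniformlyRecurrent (lerayForward a U) :=
  (isSelfSimilar_lerayForward a U).isScalingUniformlyRecurrent

/-- **Periodic orbits are uniformly recurrent**: a discretely self-similar field with factor
`λ > 1` (Chae–Wolf 2017, Def. 1.1) is uniformly recurrent under scaling, with window length the
period `L = log λ`: every window `[a, a + log λ]` contains an integer multiple of `log λ`, an exact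
return time (`IsDiscretelySelfSimilar.nsScalingFlow_int_mul_log`). For `0 < λ < 1` use
`BradshawTsai2019.isDiscretelySelfSimilar_inv` first. [folklore] -/
theorem IsDiscretelySelfSimilar.isScalingUniformlyRecurrent {c : ℝ} (hc : 1 < c) {u : ℝ → E → F}
    (h : IsDiscretelySelfSimilar c u) : IsScalingUniformlyRecurrent u := by
  have hc0 : 0 < c := one_pos.trans hc
  have hℓ : 0 < Real.log c := Real.log_pos hc
  intro ε hε K _ _
  refine ⟨Real.log c, hℓ, fun a => ?_⟩
  set n : ℤ := ⌈a / Real.log c⌉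
  refine ⟨n * Real.log c, ⟨?_, ?_⟩, ?_⟩
  · have h1 : a / Real.log c ≤ n := Int.le_ceil _
    rwa [div_le_iff₀ hℓ] at h1
  · have h1 : (n : ℝ) < a / Real.log c + 1 := Int.ceil_lt_add_one _
    have h2 : (n : ℝ) * Real.log c < (a / Real.log c + 1) * Real.log c :=
      mul_lt_mul_of_pos_right h1 hℓ
    rw [add_mul, div_mul_cancel₀ _ hℓ.ne', one_mul] at h2
    exact h2.le
  · have h1 : (fun z : ℝ × E => nsRescale (Real.exp (n * Real.log c)) u z.1 z.2 - u z.1 z.2) = 0 := by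
      funext z
      have h2 := h.nsScalingFlow_int_mul_log hc0 n
      rw [nsScalingFlow_apply] at h2
      rw [h2]
      simp
    rw [h1, eLpNorm_zero]
    exact bot_le

/-- Uniform recurrence gives return log-scales `σ → -∞`: below every `b` there is an `ε`-return
scale (the zoom-OUT limits `λ = e^σ → 0` used in Liouville arguments). [folklore] -/
theorem IsScalingUniformlyRecurrent.exists_le {u : ℝ → E → F} (h : IsScalingUniformlyRecurrent u)
    {ε : ℝ} (hε : 0 < ε) {K : Set (ℝ × E)} (hK : IsCompact K) (hKH : K ⊆ Set.Iic (0 : ℝ) ×ˢ Set.univ)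
    (b : ℝ) : ∃ σ ≤ b,
      eLpNorm (fun z : ℝ × E => nsRescale (Real.exp σ) u z.1 z.2 - u z.1 z.2) 3 (volume.restrict K) ≤
        ENNReal.ofReal ε := by
  obtain ⟨L, -, hL⟩ := h ε hε K hK hKH
  obtain ⟨σ, hσ, hσε⟩ := hL (b - L)
  exact ⟨σ, by linarith [hσ.2], hσε⟩

/-- Uniform recurrence gives return log-scales `σ → +∞`: above every `b` there is an `ε`-return
scale (zoom-IN, `λ = e^σ → ∞`). [folklore] -/
theorem IsScalingUniformlyRecurrent.exists_ge {u : ℝ → E → F} (h : IsScalingUniformlyRecurrent u)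
    {ε : ℝ} (hε : 0 < ε) {K : Set (ℝ × E)} (hK : IsCompact K) (hKH : K ⊆ Set.Iic (0 : ℝ) ×ˢ Set.univ)
    (b : ℝ) : ∃ σ ≥ b,
      eLpNorm (fun z : ℝ × E => nsRescale (Real.exp σ) u z.1 z.2 - u z.1 z.2) 3 (volume.restrict K) ≤
        ENNReal.ofReal ε := by
  obtain ⟨L, -, hL⟩ := h ε hε K hK hKH
  obtain ⟨σ, hσ, hσε⟩ := hL b
  exact ⟨σ, hσ.1, hσε⟩

/-! #### Change of variables under the parabolic dilation -/

/-- **Exact scaling law of `L^p` norms on parabolically dilated sets**: for `0 < c`, any field `w`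
and any set `S`,
`‖u_c‖_{L^p(Φ_c⁻¹ S)} = c · (c^{2+n})^{-1/p} · ‖w‖_{L^p(S)}`, `n = dim E`
(change of variables `z ↦ Φ_c z`, Jacobian `c^{2+n}`; no measurability of `w` needed). For
`p = 3`, `n = 3` the factor is `c^{-2/3}`. [folklore] -/
theorem eLpNorm_nsRescale_restrict_preimage {c : ℝ} (hc : 0 < c) (w : ℝ → E → F) (p : ℝ≥0∞)
    (S : Set (ℝ × E)) :
    eLpNorm (fun z : ℝ × E => nsRescale c w z.1 z.2) p
        (volume.restrict (stAffine (c ^ 2) c 0 (0 : E) ⁻¹' S)) =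
      ‖c‖ₑ * (ENNReal.ofReal (c ^ 2 * c ^ finrank ℝ E)⁻¹) ^ (1 / p).toReal *
        eLpNorm (fun z : ℝ × E => w z.1 z.2) p (volume.restrict S) := by
  have hc2 : 0 < c ^ 2 := by positivity
  have hk : ENNReal.ofReal (c ^ 2 * c ^ finrank ℝ E)⁻¹ ≠ 0 :=
    (ENNReal.ofReal_pos.2 (by positivity)).ne'
  rw [nsRescale_eq_smul_comp_stAffine, eLpNorm_const_smul,
    ← (measurableEmbedding_stAffine hc2.ne' hc.ne' 0 (0 : E)).eLpNorm_map_measure,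
    map_stAffine_volume_restrict_preimage hc2 hc, eLpNorm_smul_measure_of_ne_zero hk, smul_eq_mul,
    mul_assoc]

/-- The scaling law on an arbitrary set `K`, written with the IMAGE `Φ_c K`:
`‖w_c‖_{L^p(K)} = c (c^{2+n})^{-1/p} ‖w‖_{L^p(Φ_c K)}`. [folklore] -/
theorem eLpNorm_nsRescale_restrict {c : ℝ} (hc : 0 < c) (w : ℝ → E → F) (p : ℝ≥0∞)
    (K : Set (ℝ × E)) :
    eLpNorm (fun z : ℝ × E => nsRescale c w z.1 z.2) p (volume.restrict K) =
      ‖c‖ₑ * (ENNReal.ofReal (c ^ 2 * c ^ finrank ℝ E)⁻¹) ^ (1 / p).toReal *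
        eLpNorm (fun z : ℝ × E => w z.1 z.2) p
          (volume.restrict (stAffine (c ^ 2) c 0 (0 : E) '' K)) := by
  have hinj : Injective (stAffine (c ^ 2) c 0 (0 : E)) :=
    (stAffineHomeomorph (by positivity : c ^ 2 ≠ 0) hc.ne' 0 (0 : E)).injective
  conv_lhs => rw [← hinj.preimage_image K]
  exact eLpNorm_nsRescale_restrict_preimage hc w p _

/-- **Uniform recurrence is constant along orbits of the scaling flow**: if `u` is uniformly
recurrent under scaling, so is `u_c` for every `c > 0` (the `ε`-return scales of `u_c` on `K` are
those of `u` on the dilated compact set `Φ_c K ⊆ {t ≤ 0} × E`, with `ε` corrected by the exact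
factor `c (c^{2+n})^{-1/3}` of `eLpNorm_nsRescale_restrict`). [folklore] -/
theorem IsScalingUniformlyRecurrent.nsRescale {u : ℝ → E → F} (h : IsScalingUniformlyRecurrent u)
    {c : ℝ} (hc : 0 < c) : IsScalingUniformlyRecurrent (FluidPDE.nsRescale c u) := by
  intro ε hε K hK hKH
  -- the dilated compact set
  set K' : Set (ℝ × E) := stAffine (c ^ 2) c 0 (0 : E) '' K
  have hK'c : IsCompact K' := hK.image (continuous_stAffine _ _ _ _)
  have hK'H : K' ⊆ Set.Iic (0 : ℝ) ×ˢ Set.univ := image_stAffine_sq_subset_Iic_prod_univ c hKH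
  -- the exact correction factor
  set A : ℝ≥0∞ := ‖c‖ₑ * (ENNReal.ofReal (c ^ 2 * c ^ finrank ℝ E)⁻¹) ^ (1 / (3 : ℝ≥0∞)).toReal
    with hA
  have hAtop : A ≠ ⊤ :=
    ENNReal.mul_ne_top enorm_ne_top (ENNReal.rpow_ne_top_of_nonneg (by norm_num) ENNReal.ofReal_ne_top)
  have hA0 : A ≠ 0 := by
    refine mul_ne_zero ?_ ?_
    · simpa using hc.ne'
    · exact (ENNReal.rpow_pos (ENNReal.ofReal_pos.2 (by positivity)) ENNReal.ofReal_ne_top).ne'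
  have hApos : 0 < A.toReal := ENNReal.toReal_pos hA0 hAtop
  obtain ⟨L, hL, hret⟩ := h (ε / A.toReal) (div_pos hε hApos) K' hK'c hK'H
  refine ⟨L, hL, fun a => ?_⟩
  obtain ⟨σ, hσ, hσε⟩ := hret a
  refine ⟨σ, hσ, ?_⟩
  have h1 : (fun z : ℝ × E => FluidPDE.nsRescale (Real.exp σ) (FluidPDE.nsRescale c u) z.1 z.2 -
      FluidPDE.nsRescale c u z.1 z.2) =
      fun z : ℝ × E => FluidPDE.nsRescale c (FluidPDE.nsRescale (Real.exp σ) u - u) z.1 z.2 := by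
    rw [nsRescale_comm, nsRescale_sub]
    rfl
  rw [h1, eLpNorm_nsRescale_restrict hc, ← hA]
  calc A * eLpNorm (fun z : ℝ × E => (FluidPDE.nsRescale (Real.exp σ) u - u) z.1 z.2) 3
        (volume.restrict K')
      ≤ A * ENNReal.ofReal (ε / A.toReal) := mul_le_mul' le_rfl hσε
    _ = ENNReal.ofReal ε := by
      rw [← ENNReal.ofReal_toReal hAtop, ← ENNReal.ofReal_mul hApos.le, ENNReal.toReal_ofReal hApos.le,
        mul_div_cancel₀ _ hApos.ne']

/-! #### Modification on null sets -/

/-- The closed and the open lower half-spaces differ by the null hyperplane `{t = 0} × E`. [folklore] -/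
theorem Iio_prod_univ_ae_eq_Iic_prod_univ :
    (Set.Iio (0 : ℝ) ×ˢ (Set.univ : Set E) : Set (ℝ × E)) =ᵐ[volume] Set.Iic (0 : ℝ) ×ˢ Set.univ := by
  refine ae_eq_set.2 ⟨?_, ?_⟩
  · exact measure_mono_null
      (fun z hz => absurd (Set.prod_mono Iio_subset_Iic_self Subset.rfl hz.1) hz.2) measure_empty
  · refine measure_mono_null (fun z hz => ?_)
      (show volume (({0} : Set ℝ) ×ˢ (univ : Set E)) = 0 from ?_)
    · obtain ⟨hz1, hz2⟩ := hz
      simp only [mem_prod, mem_Iic, mem_univ, and_true, mem_Iio, not_lt] at hz1 hz2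
      exact ⟨le_antisymm hz1 hz2, mem_univ _⟩
    · rw [Measure.volume_eq_prod, Measure.prod_prod, Real.volume_singleton, zero_mul]

/-- An a.e. statement on the open lower half-space `{t < 0} × E` holds a.e. on every subset `K` of
the CLOSED lower half-space (the hyperplane `{t = 0} × E` is null). [folklore] -/
theorem ae_restrict_of_ae_restrict_Iio_prod_univ {P : ℝ × E → Prop}
    (h : ∀ᵐ z ∂(volume.restrict (Set.Iio (0 : ℝ) ×ˢ (Set.univ : Set E))), P z)
    {K : Set (ℝ × E)} (hK : K ⊆ Set.Iic (0 : ℝ) ×ˢ Set.univ) :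
    ∀ᵐ z ∂(volume.restrict K), P z := by
  rw [Measure.restrict_congr_set Iio_prod_univ_ae_eq_Iic_prod_univ] at h
  exact ae_restrict_of_ae_restrict_of_subset hK h

/-- **Uniform recurrence under scaling does not see null sets**: if `u` is uniformly recurrent and
`v = u` a.e. on the OPEN lower half-space `{t < 0} × E` (where ancient solutions live), then `v`
is uniformly recurrent (the dilations are non-singular, `ae_restrict_preimage_stAffine`, and
`{t = 0} × E` is null). [folklore] -/
theorem IsScalingUniformlyRecurrent.congr_ae {u v : ℝ → E → F} (hu : IsScalingUniformlyRecurrent u)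
    (h : ∀ᵐ z ∂(volume.restrict (Set.Iio (0 : ℝ) ×ˢ (Set.univ : Set E))), u z.1 z.2 = v z.1 z.2) :
    IsScalingUniformlyRecurrent v := by
  intro ε hε K hK hKH
  obtain ⟨L, hL, hret⟩ := hu ε hε K hK hKH
  refine ⟨L, hL, fun a => ?_⟩
  obtain ⟨σ, hσ, hσε⟩ := hret a
  refine ⟨σ, hσ, ?_⟩
  -- `u ∘ Φ = v ∘ Φ` a.e. on `Φ⁻¹ {t < 0} = {t < 0}`, `Φ = Φ_{e^σ}`
  have hc : 0 < Real.exp σ := Real.exp_pos σ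
  have hc2 : 0 < Real.exp σ ^ 2 := by positivity
  have hΦ := ae_restrict_preimage_stAffine hc2 hc 0 (0 : E) h
  rw [stAffine_sq_preimage_Iio_prod_univ hc.ne'] at hΦ
  have hK1 := ae_restrict_of_ae_restrict_Iio_prod_univ h hKH
  have hK2 := ae_restrict_of_ae_restrict_Iio_prod_univ hΦ hKH
  refine le_of_eq_of_le (eLpNorm_congr_ae ?_) hσε
  filter_upwards [hK1, hK2] with z hz1 hz2
  simp only [stAffine_fst, stAffine_snd, zero_add] at hz2
  simp only [nsRescale_apply, hz1, hz2]

/-! #### The dictionary with topological dynamics -/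

/-- **From Birkhoff recurrence in a model space to recurrence under scaling.** Let `X` be any
topological model of a family of fields (`ι : X → (ℝ → E → F)` the underlying field) carrying a
flow `ϕ : ℝ → X → X` that covers the scaling flow along the orbit of `p`
(`ι (ϕ σ p) = (ι p)_{e^σ}`), and suppose the `L³(K)`-balls `{q | ‖ι q − ι p‖_{L³(K)} ≤ ε}`
(`ε > 0`, `K` compact in `{t ≤ 0} × E`) are neighbourhoods of `p` — true for the `L³_loc` topology of
the closed lower half-space. If `p` is a uniformly recurrent point of `ϕ`
(`Literature.Dynamics.TopologicalDynamics.IsUniformlyRecurrentPt`; by Birkhoff's theorem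
`exists_isUniformlyRecurrentPt` every nonempty compact invariant set contains one), then the field
`ι p` is uniformly recurrent under scaling. [folklore] -/
theorem _root_.Literature.Dynamics.TopologicalDynamics.IsUniformlyRecurrentPt.isScalingUniformlyRecurrent
    {X : Type*} [TopologicalSpace X] {ϕ : ℝ → X → X} {ι : X → (ℝ → E → F)} {p : X}
    (hϕ : ∀ σ : ℝ, ι (ϕ σ p) = FluidPDE.nsRescale (Real.exp σ) (ι p))
    (hnhds : ∀ ε : ℝ, 0 < ε → ∀ K : Set (ℝ × E), IsCompact K → K ⊆ Set.Iic (0 : ℝ) ×ˢ Set.univ →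
      {q : X | eLpNorm (fun z : ℝ × E => ι q z.1 z.2 - ι p z.1 z.2) 3 (volume.restrict K) ≤
        ENNReal.ofReal ε} ∈ 𝓝 p)
    (hrec : IsUniformlyRecurrentPt ϕ p) : IsScalingUniformlyRecurrent (ι p) := by
  rw [isScalingUniformlyRecurrent_iff_isSyndetic]
  intro ε hε K hK hKH
  refine (hrec _ (hnhds ε hε K hK hKH)).mono fun σ hσ => ?_
  simpa only [mem_setOf_eq, hϕ σ] using hσ

/-- **Converse dictionary**: if the `L³(K)`-balls about `p` form a neighbourhood BASE at `p`
(every neighbourhood of `p` contains one), then uniform recurrence of the field `ι p` under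
scaling gives uniform recurrence of `p` for any flow `ϕ` covering the scaling flow along the orbit
of `p`. [folklore] -/
theorem IsScalingUniformlyRecurrent.isUniformlyRecurrentPt
    {X : Type*} [TopologicalSpace X] {ϕ : ℝ → X → X} {ι : X → (ℝ → E → F)} {p : X}
    (hϕ : ∀ σ : ℝ, ι (ϕ σ p) = FluidPDE.nsRescale (Real.exp σ) (ι p))
    (hbasis : ∀ U ∈ 𝓝 p, ∃ ε : ℝ, 0 < ε ∧ ∃ K : Set (ℝ × E), IsCompact K ∧
      K ⊆ Set.Iic (0 : ℝ) ×ˢ Set.univ ∧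
      {q : X | eLpNorm (fun z : ℝ × E => ι q z.1 z.2 - ι p z.1 z.2) 3 (volume.restrict K) ≤
        ENNReal.ofReal ε} ⊆ U)
    (hrec : IsScalingUniformlyRecurrent (ι p)) : IsUniformlyRecurrentPt ϕ p := by
  rw [isScalingUniformlyRecurrent_iff_isSyndetic] at hrec
  intro U hU
  obtain ⟨ε, hε, K, hK, hKH, hsub⟩ := hbasis U hU
  refine (hrec ε hε K hK hKH).mono fun σ hσ => hsub ?_
  simpa only [mem_setOf_eq, hϕ σ] using hσ

end Recurrence

end Literature.Analysis.FluidPDE
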